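import Summits.QuantumFields.YangMills.Theorems.BalabanUVNodesPortS1ZkGraph

/-!
# NODE O port PT-A — THE δ-JACOBIAN OF (1.4) IS A PRODUCT OF SINGLE-COARSE-BOND LOCAL FACTORS: the `b₀`-block `A₁ = recordLQtB0 Vk` of `LQ̃(V^{(k)})` is BLOCK-DIAGONAL over the coarse
# bonds `c` (the output `Q̃(·)(c′)` does not see the private variable on `b₀(c)`, `c ≠ c′` — locality of the (0.4) block averaging in its central-bond coordinates,
# `BlockAveragingHaarAC.isLocal_avgFun`), hence `det A₁ = ∏_c det A₁(c)` and `log|det A₁| = Σ_c log|det A₁(c)|` — the `|det A₁|⁻¹` factor of `recordZkLoc`∕`recordZkkLoc` (ed.15e; = the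
# canonical `Z^{(k)}` by `…PortS1ZkGraph`) contributes SINGLE-CUBE pieces to the LZ half of 27930's residue (LZ-SPEC-v1 (R-a), Z-NORMALISATION-v1 §5)

Cell `ym-nodeO-ideate`, porter seat `ymgap-nodeO-port-PTA-1` (gen 4); `--supports stmt-QuantumFields-27930` (helper).  [I] = [Balaban1987RG1].  Print p.267: «(hB)(b₀(c)) = h(c)B(c)» — `h` is LOCAL,
one operator `h(c)` per coarse bond; here its inverse-side statement for the tree's `LQ̃ = fderiv (recordQt Vk) 0`: the matrix entry `((c′, j′), (b₀(c), j))` VANISHES for `c′ ≠ c`, whether or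
not `recordQt Vk` is differentiable at `0` (if not, `fderiv = 0`).
* §1 `pert` along one coordinate direction is a `Function.update` of the background at that bond (`pert_apply_of_forall_eq_zero`, `pert_smul_single_eq_update`).
* §2 `recordQt_smul_single_b0_of_ne` — `Q̃(V^{(k)}, t·e_{(b₀(c), a)})(c′) = 0` for `c′ ≠ c` (`isLocal_avgFun` + `mlog 1 = 0`); `recordLQt_single_b0_apply_of_ne` — the same for `LQ̃` (derivative
  of a constant along the line, `HasFDerivAt.comp_hasDerivAt` + `hasDerivAt_pi` + uniqueness).
* §3 ★ `recordLQtB0_apply_of_ne` (off-diagonal blocks vanish), `recordLQtB0_submatrix_eq_blockDiagonal`, ★★ `det_recordLQtB0_eq_prod`, ★ `log_abs_det_recordLQtB0_eq_sum` (under the letter).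

HONEST FRAMING.  Bookkeeping∕locality at the record's names; NOTHING of Bałaban asserted, ported or discharged (not the letter, not differentiability of `Q̃`); 27930 OPEN; K0⁷∕K-Ax OPEN; NODE O
0∕1; COUNT 8∕28 · K 1∕4 UNMOVED; finite `𝕋⁴_{L^K}` at fixed ε — NOT continuum ∕ OS ∕ Clay; **the Yang–Mills mass gap is NOT proved by any of this.**  No `sorry`, no `def`, no `instance`.
-/

noncomputable section

open scoped BigOperators Matrix.Norms.L2Operator Topology

namespace Summit.QuantumFields.YangMills.Theorems.BalabanUVNodesPortS1

open Summit.QuantumFields.YangMills.Theorems.K0RecordFormatNames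
open Literature.MathematicalPhysics.QuantumFieldTheory.Balaban1983to89
open Literature.MathematicalPhysics.QuantumFieldTheory.Balaban1983to89.Node00
open Literature.MathematicalPhysics.QuantumFieldTheory.Balaban1983to89.T4Continuum (T4Family)
open Literature.MathematicalPhysics.QuantumFieldTheory.Balaban1983to89.BlockAveraging (avgFun)
open Literature.MathematicalPhysics.QuantumFieldTheory.Balaban1983to89.ExpMeanLog (expMeanLogSU)
open _root_.Matrix

variable (F : T4Family)

/-! ## §1  `pert` along one coordinate direction -/

/-- If the coordinate vector `x` vanishes on the bond `b′`, the perturbed configuration agrees with the background there: `pert Vk x b′ = Vk b′`. [cite: Balaban1987RG1, (2.4) p.266 (bookkeeping)] -/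
theorem pert_apply_of_forall_eq_zero (k K : ℕ) (Vk : GaugeField (F.P K) k (SU 2)) (x : FluctIdx F k K → ℝ) (b' : PBond (F.P K) k)
    (hx : ∀ a, x (b', a) = 0) : pert F k K Vk x b' = Vk b' := by
  have hmat : fluctMat F k K x b' = 0 := by
    simp only [fluctMat, hx, Complex.ofReal_zero, zero_smul, Finset.sum_const_zero]
  rw [pert, hmat, NormedSpace.exp_zero, suOfMat_of_mem (Submonoid.one_mem _)]
  exact one_mul _

open Classical in
/-- Along the coordinate direction `(b, a)` the perturbed configuration is the background UPDATED at the single bond `b`. [cite: Balaban1987RG1, (2.4) p.266 (bookkeeping)] -/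
theorem pert_smul_single_eq_update (k K : ℕ) (Vk : GaugeField (F.P K) k (SU 2)) (b : PBond (F.P K) k) (a : Fin 3) (t : ℝ) :
    pert F k K Vk (t • (Pi.single (b, a) (1 : ℝ) : FluctIdx F k K → ℝ)) =
      Function.update Vk b (pert F k K Vk (t • (Pi.single (b, a) (1 : ℝ) : FluctIdx F k K → ℝ)) b) := by
  funext b'
  by_cases hb : b' = b
  · subst hb
    rw [Function.update_self]
  · rw [Function.update_of_ne hb]
    refine pert_apply_of_forall_eq_zero F k K Vk _ b' fun a' => ?_
    have hne : (b', a') ≠ (b, a) := fun h => hb (Prod.mk.inj h).1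
    simp [hne]

/-! ## §2  `Q̃` and `LQ̃` along the private coordinate of another coarse bond vanish -/

open Classical in
/-- **`Q̃(V^{(k)}, t·e_{(b₀(c), a)})(c′) = 0` for `c′ ≠ c`**: the average at `c′` does not see the bond `b₀(c)` (`isLocal_avgFun`, standing range), so the quotient by the background average is `1`
and its logarithm `0`. [cite: Balaban1987RG1, p.267 («(hB)(b₀(c)) = h(c)B(c)»), (0.4) p.253] -/
theorem recordQt_smul_single_b0_of_ne (k K : ℕ) (hk : k + 1 ≤ (F.P K).m + (F.P K).K) (Vk : GaugeField (F.P K) k (SU 2)) {c c' : PBond (F.P K) (k + 1)} (hc : c' ≠ c)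
    (a : Fin 3) (t : ℝ) :
    recordQt F k K Vk (t • (Pi.single (recordB0 F k K c, a) (1 : ℝ) : FluctIdx F k K → ℝ)) c' = 0 := by
  have hW : (avOfRecord F 2 K k).avg (pert F k K Vk (t • (Pi.single (recordB0 F k K c, a) (1 : ℝ) : FluctIdx F k K → ℝ))) c' = (avOfRecord F 2 K k).avg Vk c' := by
    rw [pert_smul_single_eq_update, avOfRecord_avg]
    exact BlockAveragingHaarAC.isLocal_avgFun (P := F.P K) (G := SU 2) hk expMeanLogSU Vk c _ c' hc
  unfold recordQt
  rw [hW, mul_inv_cancel, OneMemClass.coe_one]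
  exact MatrixLog.mlog_one

open Classical in
/-- **`(LQ̃ e_{(b₀(c), a)})(c′) = 0` for `c′ ≠ c`** — the derivative at `0` of a function constant (`= 0`) along that line; if `Q̃(V^{(k)}, ·)` is not differentiable at `0` then `LQ̃ = 0` anyway.
[cite: Balaban1987RG1, p.267 («L is a linear transformation», «h(c)»)] -/
theorem recordLQt_single_b0_apply_of_ne (k K : ℕ) (hk : k + 1 ≤ (F.P K).m + (F.P K).K) (Vk : GaugeField (F.P K) k (SU 2)) {c c' : PBond (F.P K) (k + 1)} (hc : c' ≠ c)
    (a : Fin 3) :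
    recordLQt F k K Vk (Pi.single (recordB0 F k K c, a) (1 : ℝ)) c' = 0 := by
  set e : FluctIdx F k K → ℝ := Pi.single (recordB0 F k K c, a) (1 : ℝ) with he
  by_cases hd : DifferentiableAt ℝ (recordQt F k K Vk) 0
  · have h1 : HasFDerivAt (recordQt F k K Vk) (recordLQt F k K Vk) ((fun t : ℝ => t • e) 0) := by
      simpa [recordLQt] using hd.hasFDerivAt
    have hline : HasDerivAt (fun t : ℝ => t • e) e 0 := by
      simpa using (hasDerivAt_id (0 : ℝ)).smul_const e
    have hcomp : HasDerivAt (recordQt F k K Vk ∘ fun t : ℝ => t • e) (recordLQt F k K Vk e) 0 := h1.comp_hasDerivAt (0 : ℝ) hline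
    have hcoord : HasDerivAt (fun t : ℝ => (recordQt F k K Vk ∘ fun t : ℝ => t • e) t c') (recordLQt F k K Vk e c') 0 := (hasDerivAt_pi.mp hcomp) c'
    have hzero : (fun t : ℝ => (recordQt F k K Vk ∘ fun t : ℝ => t • e) t c') = fun _ => 0 := by
      funext t
      exact recordQt_smul_single_b0_of_ne F k K hk Vk hc a t
    rw [hzero] at hcoord
    exact hcoord.unique (hasDerivAt_const (0 : ℝ) (0 : MatA 2))
  · have h0 : recordLQt F k K Vk = 0 := by
      rw [recordLQt]
      exact fderiv_zero_of_not_differentiableAt hd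
    rw [h0]
    rfl

/-! ## §3  `A₁` is block-diagonal over the coarse bonds; its determinant factorises -/

open Classical in
/-- ★ **Off-diagonal blocks of `A₁` vanish**: `recordLQtB0 Vk (c, j) (c′, j′) = 0` for `c ≠ c′` (row `(c, j)` = output coordinate at `c`; column `(c′, j′)` = the variable on `b₀(c′)`).
[cite: Balaban1987RG1, p.267 (locality of `h`)] -/
theorem recordLQtB0_apply_of_ne (k K : ℕ) (hk : k + 1 ≤ (F.P K).m + (F.P K).K) (Vk : GaugeField (F.P K) k (SU 2)) {c c' : PBond (F.P K) (k + 1)} (hc : c ≠ c')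
    (j j' : Fin 3) : recordLQtB0 F k K Vk (c, j) (c', j') = 0 := by
  simp only [recordLQtB0, recordLQtMat]
  rw [recordLQt_single_b0_apply_of_ne F k K hk Vk hc j']
  fin_cases j <;> simp [su2Coord]

open Classical in
/-- `A₁` relabelled `(c, j) ↦ (j, c)` is `Matrix.blockDiagonal` of its `3 × 3` diagonal blocks `A₁(c) = (A₁ (c, j) (c, j′))_{j j′}`. [cite: Balaban1987RG1, p.267 (bookkeeping)] -/
theorem recordLQtB0_submatrix_eq_blockDiagonal (k K : ℕ) (hk : k + 1 ≤ (F.P K).m + (F.P K).K) (Vk : GaugeField (F.P K) k (SU 2)) :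
    (recordLQtB0 F k K Vk).submatrix (Equiv.prodComm (Fin 3) (PBond (F.P K) (k + 1))) (Equiv.prodComm (Fin 3) (PBond (F.P K) (k + 1))) =
      Matrix.blockDiagonal fun c => Matrix.of fun j j' => recordLQtB0 F k K Vk (c, j) (c, j') := by
  ext ⟨j, c⟩ ⟨j', c'⟩
  rw [Matrix.submatrix_apply, Matrix.blockDiagonal_apply]
  simp only [Equiv.prodComm_apply, Prod.swap_prod_mk]
  by_cases h : c = c'
  · subst h
    simp
  · rw [if_neg h]
    exact recordLQtB0_apply_of_ne F k K hk Vk h j j'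

open Classical in
/-- ★★ **THE δ-JACOBIAN FACTORISES OVER THE COARSE BONDS**: `det A₁ = ∏_c det A₁(c)`. [cite: Balaban1987RG1, (1.4) p.260, p.267–268] -/
theorem det_recordLQtB0_eq_prod (k K : ℕ) (hk : k + 1 ≤ (F.P K).m + (F.P K).K) (Vk : GaugeField (F.P K) k (SU 2)) :
    (recordLQtB0 F k K Vk).det = ∏ c : PBond (F.P K) (k + 1), (Matrix.of fun j j' : Fin 3 => recordLQtB0 F k K Vk (c, j) (c, j')).det := by
  rw [← Matrix.det_submatrix_equiv_self (Equiv.prodComm (Fin 3) (PBond (F.P K) (k + 1))), recordLQtB0_submatrix_eq_blockDiagonal F k K hk Vk,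
    Matrix.det_blockDiagonal]

open Classical in
/-- ★ **`log|det A₁| = Σ_c log|det A₁(c)|`** UNDER the letter `RecordB0BlockInvertible` (every block is then nonsingular): the `|det A₁|⁻¹` normalisation of `recordZkLoc`∕`recordZkkLoc` is a sum of
SINGLE-COARSE-BOND terms in the logarithm — single-cube pieces for the LZ half of 27930's residue. [cite: Balaban1987RG1, (1.4) p.260, (1.6)–(1.7) p.261, p.267–268] -/
theorem log_abs_det_recordLQtB0_eq_sum (k K : ℕ) (hk : k + 1 ≤ (F.P K).m + (F.P K).K) (Vk : GaugeField (F.P K) k (SU 2)) (hA : RecordB0BlockInvertible F k K Vk) :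
    Real.log |(recordLQtB0 F k K Vk).det| = ∑ c : PBond (F.P K) (k + 1), Real.log |(Matrix.of fun j j' : Fin 3 => recordLQtB0 F k K Vk (c, j) (c, j')).det| := by
  rw [det_recordLQtB0_eq_prod F k K hk Vk, Finset.abs_prod, Real.log_prod]
  intro c _
  have hne : (∏ c : PBond (F.P K) (k + 1), (Matrix.of fun j j' : Fin 3 => recordLQtB0 F k K Vk (c, j) (c, j')).det) ≠ 0 := by
    rw [← det_recordLQtB0_eq_prod F k K hk Vk]
    exact hA.ne_zero
  exact abs_ne_zero.mpr (Finset.prod_ne_zero_iff.mp hne c (Finset.mem_univ c))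

end Summit.QuantumFields.YangMills.Theorems.BalabanUVNodesPortS1

end
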